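import Literature.Geometry.Kaehler.SymplecticPrimitiveFormsIsotropicSpan
import Literature.Geometry.Kaehler.ComplexTorusRationalFormsBasis
import Literature.Geometry.Kaehler.ComplexTorusRationalSubspace
import HarnessLib

/-!
# Goodman–Wallach Prop. 5.5.18 over `ℚ` on a complex torus: the rational primitive classes are spanned by the
# determinant classes of the `η`-isotropic rational frames

Layer `Literature/Geometry/Kaehler`, namespace `Literature.Geometry.Kaehler.ComplexTorus`; lane `lit-hodgefound`,
seat p09, generation 23, row g23-#4 (sequel of g23-#1 `SymplecticPrimitiveFormsIsotropicSpan` — Prop. 5.5.18 with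
REAL frames — and of FILE 1 `Motives/HodgeStructureExteriorPowerPrimitiveIsotropicSpan`, which proves Goodman–Wallach's
Prop. 5.5.18 «`H(⋀ᵖ ℂ^{2l}, Ω)` is spanned by the isotropic `p`-vectors» on the abstract carrier `(⋀ W, ω_Q)` over
EVERY field of characteristic `0`; here that theorem is applied with `K = ℚ`).

## The statement

`X = E/Λ` a complex torus presented by a period isomorphism `Φ : ℝ^ι ≃ E` (`Λ = Φ(ℤ^ι)`, `Λ_ℚ = Φ(ℚ^ι)` the rational
points `Φ(ratVec q)`), `η ∈ NS(X)` (tree `IsNSForm Φ η`: a real `(1,1)`-form integral on `Λ`, Lange Prop. 1.2.9) which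
is non-degenerate, `g = dim_ℂ E`, `Hᵖ(X, ℂ) = Altᵖ_ℝ(E; ℂ)`, `Hᵖ(X, ℚ) = rationalForms Φ p` (the forms with rational
periods on lattice tuples, Lange Cor. 1.1.19), `Pᵖ(η) = primitiveForms η p = ker L_η^{g-p+1}`. For `p ≤ g`:

  **`Pᵖ(η) ∩ Hᵖ(X, ℚ) = Span_ℚ { x ↦ det (η(aᵢ, xⱼ))ᵢⱼ : a₀, …, a_{p-1} ∈ Λ_ℚ, η(aᵢ, aⱼ) = 0 }`**

(`primitiveForms_restrictScalars_inf_rationalForms_eq_span`): the rational primitive `p`-classes are exactly the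
`ℚ`-linear combinations of the classes `η(a₀, ·) ∧ ⋯ ∧ η(a_{p-1}, ·)` of the `η`-isotropic RATIONAL `p`-frames — the
rational isotropic `p`-vectors of `(H¹(X, ℚ), η⁻¹)`.

## Proof (the `ℚ`-form of the bridge of g17-#1)

* §1 The rational symplectic space `(ℚ^ι, Q)`, `Q(q, q') = η(Φq, Φq') ∈ ℚ` (a Gram matrix of integers, `IsNSForm`):
  alternating, non-degenerate (`η` non-degenerate and `Φ(e_t)` a real basis), `dim = |ι| = 2g`.
* §2 The realisation `θ : ℚ^ι → Alt¹_ℝ(E; ℂ)`, `θ(q) = η(Φq, ·)` and its multiplicative extension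
  `φ : ⋀_ℚ ℚ^ι → ⋀_ℂ Alt¹` (a `ℚ`-algebra map with `φ ∘ ι = ι ∘ θ`; `φ(v₁ ∧ ⋯ ∧ v_p) = θv₁ ∧ ⋯ ∧ θv_p`, `φ(⋀ᵖ) ⊆ ⋀ᵖ`),
  and the degree-`p` realisation `R = Ψ_p ∘ φ` into `Altᵖ` (`Ψ` the bridge `extHom` of g17-#1):
  `R(q₁ ∧ ⋯ ∧ q_p) = (x ↦ det η(Φqᵢ, xⱼ))` (`ratRealize_ιMulti_apply`).
* §3 A Darboux basis `d` of `(ℚ^ι, Q)` (FILE 1's extension theorem with `p = 0`) gives a real Darboux basis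
  `c = Φ ∘ d` of `(E, η)` made of rational vectors; `θ(dᵢ) = f̂ᵢ^*`, `θ(d_{g+i}) = -êᵢ^*` in the dual frame `ĉ`, so
  `φ(ω_Q) = ω_ĉ`, `Ψ(φ(ω_Q)) = η` (`extHom_twoVector_hatBasis`), and `φ` maps the weight basis of `d` to the weight
  basis of the `ℂ`-basis `θ ∘ d` of `Alt¹`: **`φ` is injective** (Bourbaki, *Alg.* III §7 no. 8 Thm. 1: bases of `⋀`).
* §4 `R(⋀ᵖ ℚ^ι) = Hᵖ(X, ℚ)` (`map_ratRealize_exteriorPower_eq_rationalForms`): `⊆` by the determinant formula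
  (rational entries `η(Φqᵢ, Φm_j)`), `⊇` because the lattice monomials `dx_I` (which span `Hᵖ(X, ℚ)`, tree
  `rationalForms_eq_span_latMonomial`, Lange Prop. 1.1.20) are `R` of wedges of `θ`-preimages of the `dx_a`
  (`θ` is injective of rank `2g = dim_ℚ Span_ℚ{dx_a}`).
* §5 `y ∈ Pᵖ(ω_Q) ↔ R y ∈ Pᵖ(η)` for `y ∈ ⋀ᵖ ℚ^ι` (injectivity + multiplicativity of `φ` + g17-#1
  `mem_primitive_iff_extPiece_mem`), and the theorem: `Pᵖ(η) ∩ Hᵖ(X, ℚ) = R(Pᵖ(ω_Q)) = R(Span_ℚ{isotropic p-vectors})`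
  (FILE 1 `span_ιMulti_isotropic_eq_primitive` over `K = ℚ`) `= Span_ℚ{det forms of rational isotropic frames}`;
  `⊇` by g23-#1 `det_twoForm_mem_primitiveForms` and §4.

* §6 The COMPLEX span (`primitiveForms_eq_span_det_twoForm_ratVec`): `Pᵖ(η)` itself is the `ℂ`-span of the same
  rational generators — `dim_ℂ Pᵖ(φ ω_Q) = dim_ℚ Pᵖ(ω_Q)` (the dimension of `Pᵖ` of a Darboux `2`-vector depends only
  on `(g, p)`, `finrank_primitive_twoVector_add_ite`, Voisin's count) and `φ` carries a `ℚ`-basis of `Pᵖ(ω_Q)` to a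
  `ℂ`-independent family (`ratBaseChange_linearIndependent`), so `Span_ℂ φ(Pᵖ(ω_Q)) = Pᵖ(φ ω_Q)`
  (`span_ratBaseChange_ιMulti_isotropic_eq_primitive`), transported by `Ψ`.

Theorems only (no `def`, no named fact; the auxiliary objects `Q, θ, φ, R` enter as hypotheses characterised by their
defining identities and are produced by `exists_…` theorems). Scope: `η` an NS form, non-degenerate (an abelian
variety's polarisation, or any non-degenerate `η ∈ NS(X)`); `p ≤ g`; the complex statement with REAL frames and
`η` merely non-degenerate is g23-#1; the generators here are rational (indeed integral after clearing denominators)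
classes but no integral-lattice (`ℤ`-span) statement is made.

## References

* [cite: GoodmanWallachGTM255, §5.5.2 Prop. 5.5.18 and Thm. 5.5.15 (proof)]
* [cite: Lange2023AbelianVarietiesComplex, §1.1.3 Cor. 1.1.19, §1.1.4 Prop. 1.1.20, §1.2.2 Prop. 1.2.9, §7.3.2 (p. 338)]
* [cite: BourbakiAlgebre1a3, Ch. III §7 no. 8 Thm. 1, no. 9]
* [cite: McDuffSalamon2017, §2.1 Thm. 2.1.3, Lemma 2.1.5]
* [cite: Voisin2002, Lemma 6.24, Prop. 6.22]
* [cite: Warner1983, 2.6]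
-/

noncomputable section

namespace Literature.AlgebraicGeometry.Motives

namespace ExteriorLefschetz

open Module

/-- **`dim Pᵖ` depends only on `(g, p)`**: for a Darboux basis `b` over any field of characteristic `0` and `p ≤ g`,
`dim_K Pᵖ(ω_b) + C(2g, p-2) = C(2g, p)` for `p ≥ 2` and `dim_K Pᵖ(ω_b) = C(2g, p)` for `p ≤ 1` (Q573's
`finrank_primitive_add` — Voisin's count `h_prim = h - h` — and `Pᵖ = ⋀ᵖ` in degrees `≤ 1`), packaged with an
`if` so that two fields can be compared term by term. [cite: Voisin2002, Lemma 6.24] [cite: GoodmanWallachGTM255, §5.5.2 Cor. 5.5.17] -/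
theorem finrank_primitive_twoVector_add_ite {K : Type*} [Field K] [CharZero K] {W : Type*} [AddCommGroup W]
    [Module K W] {g : ℕ} (b : Basis (Fin g ⊕ Fin g) K W) {p : ℕ} (hp : p ≤ g) :
    finrank K (primitive (twoVector b) g p) + (if 2 ≤ p then (2 * g).choose (p - 2) else 0) = (2 * g).choose p := by
  haveI := (isSymplectic_twoVector b).finite
  split_ifs with h2
  · rw [← (Submodule.comapSubtypeEquivOfLe (primitive_le (twoVector b) g p)).finrank_eq]
    exact (isSymplectic_twoVector b).finrank_primitive_add (k := p - 2) (m := p) (by omega) hp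
  · have heq : primitive (twoVector b) g p = ⋀[K]^p W :=
      le_antisymm (primitive_le _ _ _) ((isSymplectic_twoVector b).le_primitive_of_le_one (by omega))
    rw [add_zero, heq, exteriorPower.finrank_eq, (isSymplectic_twoVector b).finrank_eq]

end ExteriorLefschetz

end Literature.AlgebraicGeometry.Motives

namespace Literature.Geometry.Kaehler

namespace ComplexTorus

open Module Finset
open Literature.LinearAlgebra.Alternating (wedgeWord)
open Literature.LinearAlgebra.Alternating.GForm (hat hat_apply hatBasis hatBasis_apply hatBasis_apply_basis extPiece
  extPiece_apply extHom extHom_ιMulti_hat extHom_coe_eq_of oneForm0 of of_apply_self coordCov extHom_twoVector_hatBasis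
  mem_primitive_iff_extPiece_mem oneForm_eq_of_apply_basis extPiece_bijective)
open Literature.AlgebraicGeometry.Motives.ExteriorLefschetz (twoVector twoVector_mem twoVectorOfForm twoVectorOfForm_mem
  twoVectorOfForm_eq_twoVector primitive primitive_le mem_primitive_iff weightBasis weightBasis_apply interleaved
  interleaved_apply isSymplectic_twoVector exists_symplecticBasis_extending_isotropic span_ιMulti_isotropic_eq_primitive
  ιMulti_mem_primitive_of_isotropic finrank_primitive_twoVector_add_ite)

variable {ι : Type*} {E : Type*} [NormedAddCommGroup E] [NormedSpace ℂ E] (Φ : (ι → ℝ) ≃L[ℝ] E)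
  {η : E [⋀^Fin 2]→L[ℝ] ℝ}

/-! ## §1 The rational symplectic space `(ℚ^ι, Q)`, `Q = η|_{Λ_ℚ}` -/

section RationalForm

/-- `α(w, v) = -α(v, w)` for a `2`-form. [folklore] -/
private theorem twoForm_swap'' (α : E [⋀^Fin 2]→L[ℝ] ℝ) (v w : E) : α ![w, v] = -α ![v, w] := by
  have h := α.map_swap ![v, w] (show (0 : Fin 2) ≠ 1 by decide)
  have hs : (![v, w] ∘ Equiv.swap (0 : Fin 2) 1) = ![w, v] := by
    funext i
    fin_cases i <;> rfl
  rw [hs] at h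
  exact h

/-- A real vector of `ℝ^ι` in the standard basis: `x = Σ_t x_t e_t`. [folklore] -/
private theorem eq_sum_smul_single' [Fintype ι] [DecidableEq ι] (x : ι → ℝ) :
    x = ∑ t, x t • (Pi.single t (1 : ℝ) : ι → ℝ) := by
  funext i
  simp only [Finset.sum_apply, Pi.smul_apply, Pi.single_apply, smul_eq_mul, mul_ite, mul_one, mul_zero,
    Finset.sum_ite_eq, Finset.mem_univ, if_true]

/-- `Φ(x) = Σ_t x_t Φ(e_t)`: the lattice basis `Φ(e_t)` is a real basis of `E`.
[cite: Lange2023AbelianVarietiesComplex, §1.1.4 Prop. 1.1.20] -/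
theorem apply_eq_sum_smul_apply_single [Fintype ι] [DecidableEq ι] (x : ι → ℝ) :
    Φ x = ∑ t, x t • Φ (Pi.single t 1) := by
  conv_lhs => rw [eq_sum_smul_single' x]
  rw [map_sum]
  exact Finset.sum_congr rfl fun t _ ↦ by rw [map_smul]

/-- A rational vector: `Φ(q) = Σ_s q_s Φ(e_s)`. [cite: Lange2023AbelianVarietiesComplex, §1.1.4 Prop. 1.1.20] -/
theorem apply_ratVec_eq_sum_smul_apply_single [Fintype ι] [DecidableEq ι] (q : ι → ℚ) :
    Φ (ratVec q) = ∑ s, ((q s : ℚ) : ℝ) • Φ (Pi.single s 1) :=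
  apply_eq_sum_smul_apply_single Φ (ratVec q)

/-- `ratVec e_t = e_t`. [folklore] -/
private theorem ratVec_single' [DecidableEq ι] (t : ι) : ratVec (Pi.single t (1 : ℚ)) = Pi.single t (1 : ℝ) := by
  funext i
  rw [ratVec_apply, Pi.single_apply, Pi.single_apply]
  split_ifs <;> simp

/-- **`η` is a rational bilinear form on `Λ_ℚ`**: with `G_{st} = η(Φe_s, Φe_t) ∈ ℚ` the Gram matrix,
`η(Φq, Φq') = Σ_{s,t} q_s G_{st} q'_t = (toBilin' G)(q, q')`. [cite: Lange2023AbelianVarietiesComplex, §1.2.2 Prop. 1.2.9] -/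
theorem twoForm_ratVec_eq_ratCast_toBilin' [Fintype ι] [DecidableEq ι] (B : LinearMap.BilinForm ℝ E)
    (hB : ∀ v w, B v w = η ![v, w]) (G : Matrix ι ι ℚ)
    (hG : ∀ s t, ((G s t : ℚ) : ℝ) = η ![Φ (Pi.single s 1), Φ (Pi.single t 1)]) (q q' : ι → ℚ) :
    η ![Φ (ratVec q), Φ (ratVec q')] = ((Matrix.toBilin' G q q' : ℚ) : ℝ) := by
  rw [← hB, apply_ratVec_eq_sum_smul_apply_single Φ q, apply_ratVec_eq_sum_smul_apply_single Φ q',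
    LinearMap.BilinForm.sum_left, Matrix.toBilin'_apply]
  push_cast
  refine Finset.sum_congr rfl fun s _ ↦ ?_
  rw [LinearMap.BilinForm.smul_left, LinearMap.BilinForm.sum_right, Finset.mul_sum]
  refine Finset.sum_congr rfl fun t _ ↦ ?_
  rw [LinearMap.BilinForm.smul_right, hB, ← hG]
  ring

/-- **The Gram matrix of an NS form on the lattice basis is integral** (`η(Λ, Λ) ⊆ ℤ`), in particular rational.
[cite: Lange2023AbelianVarietiesComplex, §1.2.2 Prop. 1.2.9] -/
theorem IsNSForm.exists_gram [Fintype ι] [DecidableEq ι] (hη : IsNSForm Φ η) :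
    ∃ G : Matrix ι ι ℚ, ∀ s t, ((G s t : ℚ) : ℝ) = η ![Φ (Pi.single s 1), Φ (Pi.single t 1)] := by
  choose k hk using hη.integral
  refine ⟨fun s t ↦ (k (Pi.single s 1) (Pi.single t 1) : ℚ), fun s t ↦ ?_⟩
  rw [Rat.cast_intCast, ← hk]
  simp only [latticeVec_single]

/-- **`η ∈ NS(X)` is rational on `Λ_ℚ`**: there is a rational bilinear form `Q` on `ℚ^ι` with
`η(Φq, Φq') = Q(q, q')`. [cite: Lange2023AbelianVarietiesComplex, §1.2.2 Prop. 1.2.9] -/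
theorem IsNSForm.exists_bilinForm_rat [Fintype ι] (hη : IsNSForm Φ η) :
    ∃ Q : LinearMap.BilinForm ℚ (ι → ℚ), ∀ q q', ((Q q q' : ℚ) : ℝ) = η ![Φ (ratVec q), Φ (ratVec q')] := by
  classical
  obtain ⟨B, -, hB⟩ := Literature.Geometry.Symplectic.exists_bilinForm_eq_twoForm η
  obtain ⟨G, hG⟩ := hη.exists_gram
  exact ⟨Matrix.toBilin' G, fun q q' ↦ (twoForm_ratVec_eq_ratCast_toBilin' Φ B hB G hG q q').symm⟩

variable {Q : LinearMap.BilinForm ℚ (ι → ℚ)}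

/-- `Q` is alternating (`η` is). [cite: McDuffSalamon2017, §2.1 (symplectic vector spaces)] -/
theorem isAlt_of_ratCast_eq_twoForm (hQ : ∀ q q', ((Q q q' : ℚ) : ℝ) = η ![Φ (ratVec q), Φ (ratVec q')]) : Q.IsAlt := by
  intro q
  have h := hQ q q
  rw [η.map_eq_zero_of_eq ![Φ (ratVec q), Φ (ratVec q)] (i := 0) (j := 1) rfl zero_ne_one] at h
  exact_mod_cast h

/-- **`Q` is non-degenerate when `η` is**: `Q(q, ·) = 0` forces `η(Φq, Φe_t) = 0` for the real basis `Φe_t` of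
`E`, so `η(Φq, ·) = 0` and `q = 0`. [cite: McDuffSalamon2017, §2.1 (symplectic vector spaces)] -/
theorem nondegenerate_of_ratCast_eq_twoForm [Fintype ι] (hnd : ∀ v : E, v ≠ 0 → ∃ w : E, η ![v, w] ≠ 0)
    (B : LinearMap.BilinForm ℝ E) (hB : ∀ v w, B v w = η ![v, w])
    (hQ : ∀ q q', ((Q q q' : ℚ) : ℝ) = η ![Φ (ratVec q), Φ (ratVec q')]) : Q.Nondegenerate := by
  classical
  refine (LinearMap.IsRefl.nondegenerate_iff_separatingLeft (isAlt_of_ratCast_eq_twoForm Φ hQ).isRefl).2 fun q hq ↦ ?_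
  by_contra hne
  have hv : Φ (ratVec q) ≠ 0 := by
    intro h
    apply hne
    have h0 : ratVec q = ratVec (0 : ι → ℚ) := by
      have h1 : ratVec q = 0 := Φ.injective (h.trans (map_zero Φ).symm)
      rw [h1]
      funext i
      rw [Pi.zero_apply, ratVec_apply, Pi.zero_apply, Rat.cast_zero]
    exact ratVec_injective h0
  obtain ⟨w, hw⟩ := hnd _ hv
  apply hw
  rw [← Φ.apply_symm_apply w, apply_eq_sum_smul_apply_single Φ (Φ.symm w), ← hB, LinearMap.BilinForm.sum_right]
  refine Finset.sum_eq_zero fun t _ ↦ ?_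
  have h1 := hQ q (Pi.single t 1)
  rw [hq (Pi.single t 1), Rat.cast_zero, ratVec_single'] at h1
  rw [LinearMap.BilinForm.smul_right, hB, ← h1, mul_zero]

include Φ in
/-- `dim_ℚ ℚ^ι = 2 dim_ℂ E`. [cite: Lange2023AbelianVarietiesComplex, §1.1.3 Cor. 1.1.19] -/
theorem finrank_ratFun_eq_two_mul_finrank [Fintype ι] [FiniteDimensional ℂ E] : finrank ℚ (ι → ℚ) = 2 * finrank ℂ E := by
  rw [Module.finrank_fintype_fun_eq_card, card_eq_two_mul_finrank Φ]

end RationalForm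

/-! ## §2 The realisation `θ(q) = η(Φq, ·)`, its multiplicative extension `φ`, and `R = Ψ_p ∘ φ` -/

section Realisation

variable {Q : LinearMap.BilinForm ℚ (ι → ℚ)}

/-- The `ℚ`-action on the complex exterior algebra is through `ℚ ⊂ ℂ`. [folklore] -/
private theorem rat_smul_eq' (a : ℚ) (x : ExteriorAlgebra ℂ (E [⋀^Fin 1]→L[ℝ] ℂ)) : a • x = (a : ℂ) • x := by
  rw [← algebraMap_smul ℂ a x]
  rfl

/-- **The realisation `θ : ℚ^ι → Alt¹_ℝ(E; ℂ)`, `θ(q) = η(Φq, ·)`** (the covector `η(a, ·)` of the rational vector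
`a = Φq`, read as a complex-valued `1`-form) exists as a `ℚ`-linear map.
[cite: Lange2023AbelianVarietiesComplex, §7.3.2 (proof of Lemma 7.3.7, p. 339)] -/
theorem exists_ratCovector [FiniteDimensional ℂ E] (B : LinearMap.BilinForm ℝ E) (hB : ∀ v w, B v w = η ![v, w]) :
    ∃ θ : (ι → ℚ) →ₗ[ℚ] (E [⋀^Fin 1]→L[ℝ] ℂ), ∀ q v, θ q v = (η ![Φ (ratVec q), v 0] : ℂ) := by
  refine ⟨{ toFun := fun q ↦ hat ((B (Φ (ratVec q))).toContinuousLinearMap)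
            map_add' := fun q q' ↦ ?_
            map_smul' := fun a q ↦ ?_ }, fun q v ↦ ?_⟩
  · ext v
    have h : ratVec (q + q') = ratVec q + ratVec q' := by
      funext i
      rw [Pi.add_apply, ratVec_apply, ratVec_apply, ratVec_apply, Pi.add_apply, Rat.cast_add]
    rw [ContinuousAlternatingMap.add_apply, hat_apply, hat_apply, hat_apply, LinearMap.coe_toContinuousLinearMap',
      LinearMap.coe_toContinuousLinearMap', LinearMap.coe_toContinuousLinearMap', h, map_add, map_add,
      LinearMap.add_apply, Complex.ofReal_add]
  · ext v
    have h : ratVec (a • q) = (a : ℝ) • ratVec q := by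
      funext i
      rw [Pi.smul_apply, ratVec_apply, ratVec_apply, Pi.smul_apply, smul_eq_mul, smul_eq_mul, Rat.cast_mul]
    rw [RingHom.id_apply, ContinuousAlternatingMap.smul_apply, hat_apply, hat_apply,
      LinearMap.coe_toContinuousLinearMap', LinearMap.coe_toContinuousLinearMap', h, map_smul, map_smul,
      LinearMap.smul_apply, smul_eq_mul, Complex.ofReal_mul, Complex.ofReal_ratCast, Rat.smul_def]
  · show hat ((B (Φ (ratVec q))).toContinuousLinearMap) v = _
    rw [hat_apply, LinearMap.coe_toContinuousLinearMap', hB]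

/-- **The multiplicative extension `φ : ⋀_ℚ ℚ^ι → ⋀_ℂ Alt¹_ℝ(E; ℂ)` of `θ`** (universal property of the exterior
algebra: `θ(q) ∧ θ(q) = 0`). [cite: BourbakiAlgebre1a3, Ch. III §7 no. 1 Prop. 1] -/
theorem exists_ratBaseChange (θ : (ι → ℚ) →ₗ[ℚ] (E [⋀^Fin 1]→L[ℝ] ℂ)) :
    ∃ φ : ExteriorAlgebra ℚ (ι → ℚ) →ₐ[ℚ] ExteriorAlgebra ℂ (E [⋀^Fin 1]→L[ℝ] ℂ),
      ∀ q, φ (ExteriorAlgebra.ι ℚ q) = ExteriorAlgebra.ι ℂ (θ q) := by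
  refine ⟨ExteriorAlgebra.lift ℚ ⟨(ExteriorAlgebra.ι ℂ).restrictScalars ℚ ∘ₗ θ, fun q ↦ ?_⟩, fun q ↦ ?_⟩
  · simp only [LinearMap.coe_comp, Function.comp_apply, LinearMap.coe_restrictScalars]
    exact ExteriorAlgebra.ι_sq_zero _
  · rw [ExteriorAlgebra.lift_ι_apply]
    rfl

/-- **The degree-`p` realisation `R = Ψ_p ∘ φ : ⋀_ℚ ℚ^ι → Altᵖ_ℝ(E; ℂ)`** (`Ψ` the bridge `extHom` of g17-#1) as a
`ℚ`-linear map. [cite: Warner1983, 2.6] -/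
theorem exists_ratRealize (φ : ExteriorAlgebra ℚ (ι → ℚ) →ₐ[ℚ] ExteriorAlgebra ℂ (E [⋀^Fin 1]→L[ℝ] ℂ)) (p : ℕ) :
    ∃ R : ExteriorAlgebra ℚ (ι → ℚ) →ₗ[ℚ] (E [⋀^Fin p]→L[ℝ] ℂ), ∀ y, R y = extHom (φ y) p :=
  ⟨((LinearMap.proj p : Literature.LinearAlgebra.Alternating.GForm E ℂ →ₗ[ℂ] (E [⋀^Fin p]→L[ℝ] ℂ)).restrictScalars ℚ) ∘ₗ
    ((extHom (E := E)).toLinearMap.restrictScalars ℚ) ∘ₗ φ.toLinearMap, fun _ ↦ rfl⟩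

variable {θ : (ι → ℚ) →ₗ[ℚ] (E [⋀^Fin 1]→L[ℝ] ℂ)}
  {φ : ExteriorAlgebra ℚ (ι → ℚ) →ₐ[ℚ] ExteriorAlgebra ℂ (E [⋀^Fin 1]→L[ℝ] ℂ)}

/-- `φ(q₁ ∧ ⋯ ∧ qₙ) = θq₁ ∧ ⋯ ∧ θqₙ`. [cite: BourbakiAlgebre1a3, Ch. III §7 no. 1 Prop. 1] -/
theorem ratBaseChange_ιMulti (hφ : ∀ q, φ (ExteriorAlgebra.ι ℚ q) = ExteriorAlgebra.ι ℂ (θ q)) {n : ℕ}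
    (m : Fin n → ι → ℚ) :
    φ (ExteriorAlgebra.ιMulti ℚ n m) = ExteriorAlgebra.ιMulti ℂ n (fun i ↦ θ (m i)) := by
  rw [ExteriorAlgebra.ιMulti_apply, ExteriorAlgebra.ιMulti_apply, map_list_prod, List.map_ofFn]
  congr 2
  funext i
  rw [Function.comp_apply, hφ]

/-- `φ(⋀ⁿ_ℚ) ⊆ ⋀ⁿ_ℂ`. [cite: BourbakiAlgebre1a3, Ch. III §7 no. 1 Prop. 1] -/
theorem ratBaseChange_mem_exteriorPower (hφ : ∀ q, φ (ExteriorAlgebra.ι ℚ q) = ExteriorAlgebra.ι ℂ (θ q)) {n : ℕ}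
    {x : ExteriorAlgebra ℚ (ι → ℚ)} (hx : x ∈ ⋀[ℚ]^n (ι → ℚ)) : φ x ∈ ⋀[ℂ]^n (E [⋀^Fin 1]→L[ℝ] ℂ) := by
  rw [← ExteriorAlgebra.ιMulti_span_fixedDegree] at hx
  induction hx using Submodule.span_induction with
  | mem x h =>
    obtain ⟨m, rfl⟩ := h
    rw [ratBaseChange_ιMulti hφ]
    exact ExteriorAlgebra.ιMulti_range ℂ n ⟨_, rfl⟩
  | zero =>
    rw [map_zero]
    exact Submodule.zero_mem _
  | add x y _ _ hx hy =>
    rw [map_add]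
    exact Submodule.add_mem _ hx hy
  | smul a x _ hx =>
    rw [map_smul, rat_smul_eq']
    exact Submodule.smul_mem _ _ hx

/-- **`R(q₁ ∧ ⋯ ∧ q_p)` is the determinant form `x ↦ det (η(Φqᵢ, xⱼ))`** of the rational frame `Φq`
(g23-#1 `extPiece_ιMulti_hat_apply`). [cite: Warner1983, 2.6] [cite: Lange2023AbelianVarietiesComplex, §1.1.3 Cor. 1.1.19] -/
theorem ratRealize_ιMulti_apply [FiniteDimensional ℂ E] (hθ : ∀ q v, θ q v = (η ![Φ (ratVec q), v 0] : ℂ))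
    (hφ : ∀ q, φ (ExteriorAlgebra.ι ℚ q) = ExteriorAlgebra.ι ℂ (θ q)) {p : ℕ}
    {R : ExteriorAlgebra ℚ (ι → ℚ) →ₗ[ℚ] (E [⋀^Fin p]→L[ℝ] ℂ)} (hR : ∀ y, R y = extHom (φ y) p)
    (m : Fin p → ι → ℚ) (x : Fin p → E) :
    R (ExteriorAlgebra.ιMulti ℚ p m) x = (Matrix.of fun i j ↦ (η ![Φ (ratVec (m i)), x j] : ℂ)).det := by
  obtain ⟨B, -, hB⟩ := Literature.Geometry.Symplectic.exists_bilinForm_eq_twoForm η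
  set θ₀ : Fin p → (E →L[ℝ] ℝ) := fun i ↦ (B (Φ (ratVec (m i)))).toContinuousLinearMap with hθ₀
  have hθ₀v : ∀ i y, θ₀ i y = η ![Φ (ratVec (m i)), y] := fun i y ↦ by
    rw [hθ₀]
    dsimp only
    rw [LinearMap.coe_toContinuousLinearMap', hB]
  have hι : (ExteriorAlgebra.ιMulti ℂ p fun i ↦ θ (m i)) = ExteriorAlgebra.ιMulti ℂ p fun i ↦ hat (θ₀ i) := by
    congr 1
    funext i
    ext v
    rw [hθ, hat_apply, hθ₀v]
  have h := extHom_coe_eq_of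
    (⟨ExteriorAlgebra.ιMulti ℂ p (fun i ↦ hat (θ₀ i)), ιMulti_hat_mem θ₀⟩ : ⋀[ℂ]^p (E [⋀^Fin 1]→L[ℝ] ℂ))
  rw [Subtype.coe_mk] at h
  rw [hR, ratBaseChange_ιMulti hφ, hι, h, of_apply_self, extPiece_ιMulti_hat_apply]
  congr 1
  ext i j
  rw [Matrix.of_apply, Matrix.of_apply, hθ₀v]

/-- `R(⋀ᵖ_ℚ) ⊆ Hᵖ(X, ℚ)`: the determinant forms of rational frames have rational periods
`det (η(Φqᵢ, Φm_j))` on lattice tuples. [cite: Lange2023AbelianVarietiesComplex, §1.1.3 Cor. 1.1.19, §1.2.2 Prop. 1.2.9] -/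
theorem ratRealize_mem_rationalForms [FiniteDimensional ℂ E]
    (hQ : ∀ q q', ((Q q q' : ℚ) : ℝ) = η ![Φ (ratVec q), Φ (ratVec q')])
    (hθ : ∀ q v, θ q v = (η ![Φ (ratVec q), v 0] : ℂ))
    (hφ : ∀ q, φ (ExteriorAlgebra.ι ℚ q) = ExteriorAlgebra.ι ℂ (θ q)) {p : ℕ}
    {R : ExteriorAlgebra ℚ (ι → ℚ) →ₗ[ℚ] (E [⋀^Fin p]→L[ℝ] ℂ)} (hR : ∀ y, R y = extHom (φ y) p)
    {y : ExteriorAlgebra ℚ (ι → ℚ)} (hy : y ∈ ⋀[ℚ]^p (ι → ℚ)) : R y ∈ rationalForms Φ p := by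
  rw [← ExteriorAlgebra.ιMulti_span_fixedDegree] at hy
  induction hy using Submodule.span_induction with
  | mem y h =>
    obtain ⟨m, rfl⟩ := h
    rw [mem_rationalForms_iff]
    intro n
    refine ⟨(Matrix.of fun i j ↦ Q (m i) (fun s ↦ ((n j s : ℤ) : ℚ))).det, ?_⟩
    rw [ratRealize_ιMulti_apply Φ hθ hφ hR]
    have hl : ∀ j, latticeTuple Φ n j = Φ (ratVec fun s ↦ ((n j s : ℤ) : ℚ)) := fun j ↦ by
      show Φ (fun s ↦ ((n j s : ℤ) : ℝ)) = Φ _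
      exact congrArg Φ (funext fun s ↦ (Rat.cast_intCast (n j s)).symm)
    have he : (Matrix.of fun i j ↦ (η ![Φ (ratVec (m i)), latticeTuple Φ n j] : ℂ)) =
        (Rat.castHom ℂ).mapMatrix (Matrix.of fun i j ↦ Q (m i) (fun s ↦ ((n j s : ℤ) : ℚ))) := by
      ext i j
      rw [RingHom.mapMatrix_apply, Matrix.map_apply, Matrix.of_apply, Matrix.of_apply, eq_ratCast,
        ← Complex.ofReal_ratCast, hQ, hl]
    rw [he, ← RingHom.map_det, eq_ratCast]
  | zero =>
    rw [map_zero]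
    exact Submodule.zero_mem _
  | add x y _ _ hx hy =>
    rw [map_add]
    exact Submodule.add_mem _ hx hy
  | smul a x _ hx =>
    rw [map_smul]
    exact Submodule.smul_mem _ a hx

end Realisation

/-! ## §3 A rational Darboux basis of `(E, η)`; `φ(ω_Q) = ω_ĉ`, `Ψ(φ(ω_Q)) = η`; `φ` is injective -/

section Darboux

variable {Q : LinearMap.BilinForm ℚ (ι → ℚ)} {θ : (ι → ℚ) →ₗ[ℚ] (E [⋀^Fin 1]→L[ℝ] ℂ)}
  {φ : ExteriorAlgebra ℚ (ι → ℚ) →ₐ[ℚ] ExteriorAlgebra ℂ (E [⋀^Fin 1]→L[ℝ] ℂ)}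

/-- **A rational Darboux basis**: a Darboux basis `d = (d_i; d_{g+i})` of `(ℚ^ι, Q)` over `ℚ` (the symplectic basis
theorem over the field `ℚ`, FILE 1 `exists_symplecticBasis_extending_isotropic` with `p = 0`; `dim_ℚ = 2g`,
`g = dim_ℂ E`) yields a REAL Darboux basis `c = Φ ∘ d` of `(E, η)` consisting of rational vectors
(`ℚ`-independent rational vectors are `ℝ`-independent, tree `linearIndependent_ratVec_iff`).
[cite: McDuffSalamon2017, §2.1 Thm. 2.1.3] [cite: Lange2023AbelianVarietiesComplex, §7.3.2 (p. 338)] -/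
theorem exists_rat_darbouxBasis [Fintype ι] [FiniteDimensional ℂ E] (hnd : ∀ v : E, v ≠ 0 → ∃ w : E, η ![v, w] ≠ 0)
    (B : LinearMap.BilinForm ℝ E) (hB : ∀ v w, B v w = η ![v, w])
    (hQ : ∀ q q', ((Q q q' : ℚ) : ℝ) = η ![Φ (ratVec q), Φ (ratVec q')]) :
    ∃ (d : Basis (Fin (finrank ℂ E) ⊕ Fin (finrank ℂ E)) ℚ (ι → ℚ))
      (c : Basis (Fin (finrank ℂ E) ⊕ Fin (finrank ℂ E)) ℝ E),
      (∀ i j, Q (d (Sum.inl i)) (d (Sum.inl j)) = 0) ∧ (∀ i j, Q (d (Sum.inr i)) (d (Sum.inr j)) = 0) ∧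
      (∀ i j, Q (d (Sum.inl i)) (d (Sum.inr j)) = if i = j then 1 else 0) ∧
      (∀ i j, η ![c (Sum.inl i), c (Sum.inl j)] = 0) ∧ (∀ i j, η ![c (Sum.inr i), c (Sum.inr j)] = 0) ∧
      (∀ i j, η ![c (Sum.inl i), c (Sum.inr j)] = if i = j then 1 else 0) ∧ ∀ s, c s = Φ (ratVec (d s)) := by
  classical
  obtain ⟨_hpg, d, _hd, hll, hrr, hlr⟩ := exists_symplecticBasis_extending_isotropic
    (nondegenerate_of_ratCast_eq_twoForm Φ hnd B hB hQ) (isAlt_of_ratCast_eq_twoForm Φ hQ) (finrank_ratFun_eq_two_mul_finrank Φ) (p := 0)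
    (fun i ↦ Fin.elim0 i) linearIndependent_empty_type (fun i ↦ Fin.elim0 i)
  -- the real family `Φ(d_s)` is a basis of `E`
  have hli : LinearIndependent ℝ fun s ↦ Φ (ratVec (d s)) :=
    ((linearIndependent_ratVec_iff _).2 d.linearIndependent).map' (Φ.toLinearEquiv : (ι → ℝ) →ₗ[ℝ] E)
      (LinearEquiv.ker Φ.toLinearEquiv)
  have hsp : ⊤ ≤ Submodule.span ℝ (Set.range fun s ↦ Φ (ratVec (d s))) := by
    refine (Submodule.eq_top_of_finrank_eq ?_).ge
    have h : finrank ℝ (Submodule.span ℝ (Set.range fun s ↦ Φ (ratVec (d s)))) = _ := finrank_span_eq_card hli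
    rw [h, Fintype.card_sum, Fintype.card_fin, finrank_real_of_complex]
    ring
  refine ⟨d, Basis.mk hli hsp, hll, hrr, hlr, fun i j ↦ ?_, fun i j ↦ ?_, fun i j ↦ ?_, fun s ↦ Basis.mk_apply hli hsp s⟩
  · rw [Basis.mk_apply, Basis.mk_apply, ← hQ, hll, Rat.cast_zero]
  · rw [Basis.mk_apply, Basis.mk_apply, ← hQ, hrr, Rat.cast_zero]
  · rw [Basis.mk_apply, Basis.mk_apply, ← hQ, hlr]
    by_cases h : i = j
    · rw [if_pos h, if_pos h, Rat.cast_one]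
    · rw [if_neg h, if_neg h, Rat.cast_zero]

variable {g : ℕ} (c : Basis (Fin g ⊕ Fin g) ℝ E) (d : Basis (Fin g ⊕ Fin g) ℚ (ι → ℚ))

/-- **`θ(d_i) = f̂ᵢ^*`**: the covector `η(eᵢ, ·)` of a Darboux vector `eᵢ` is the dual coordinate `fᵢ^*`
("`E` restricts to isomorphisms `Hom(V^±) → V^∓`"). [cite: Lange2023AbelianVarietiesComplex, §7.3.2 (proof of Lemma 7.3.7, p. 339)] -/
theorem ratCovector_darboux_inl [FiniteDimensional ℂ E] (hθ : ∀ q v, θ q v = (η ![Φ (ratVec q), v 0] : ℂ))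
    (hc : ∀ s, c s = Φ (ratVec (d s))) (hll : ∀ i j, η ![c (Sum.inl i), c (Sum.inl j)] = 0)
    (hlr : ∀ i j, η ![c (Sum.inl i), c (Sum.inr j)] = if i = j then 1 else 0) (i : Fin g) :
    θ (d (Sum.inl i)) = hatBasis c (Sum.inr i) := by
  refine oneForm_eq_of_apply_basis c fun l ↦ ?_
  rw [hθ, Matrix.cons_val_zero, ← hc (Sum.inl i), hatBasis_apply_basis]
  rcases l with j | j
  · rw [hll, if_neg Sum.inl_ne_inr]
  · rw [hlr]
    by_cases h : i = j
    · subst h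
      rw [if_pos rfl, if_pos rfl]
    · rw [if_neg h, if_neg fun h' ↦ h (Sum.inr_injective h').symm]

/-- **`θ(d_{g+i}) = -êᵢ^*`**: the covector `η(fᵢ, ·)` is `-eᵢ^*`. [cite: Lange2023AbelianVarietiesComplex, §7.3.2 (proof of Lemma 7.3.7, p. 339)] -/
theorem ratCovector_darboux_inr [FiniteDimensional ℂ E] (hθ : ∀ q v, θ q v = (η ![Φ (ratVec q), v 0] : ℂ))
    (hc : ∀ s, c s = Φ (ratVec (d s))) (hrr : ∀ i j, η ![c (Sum.inr i), c (Sum.inr j)] = 0)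
    (hlr : ∀ i j, η ![c (Sum.inl i), c (Sum.inr j)] = if i = j then 1 else 0) (i : Fin g) :
    θ (d (Sum.inr i)) = -hatBasis c (Sum.inl i) := by
  refine oneForm_eq_of_apply_basis c fun l ↦ ?_
  rw [hθ, Matrix.cons_val_zero, ← hc (Sum.inr i), ContinuousAlternatingMap.neg_apply, hatBasis_apply_basis]
  rcases l with j | j
  · rw [twoForm_swap'' η, hlr]
    by_cases h : j = i
    · subst h
      rw [if_pos rfl, if_pos rfl, Complex.ofReal_neg]
    · rw [if_neg h, if_neg fun h' ↦ h (Sum.inl_injective h'), neg_zero, Complex.ofReal_zero, neg_zero]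
  · rw [hrr, if_neg Sum.inr_ne_inl, Complex.ofReal_zero, neg_zero]

/-- **`φ(ω_d) = ω_ĉ`**: `φ(Σ dᵢ ∧ d_{g+i}) = Σ f̂ᵢ^* ∧ (-êᵢ^*) = Σ êᵢ^* ∧ f̂ᵢ^*`.
[cite: Lange2023AbelianVarietiesComplex, §7.3.2 (p. 338)] -/
theorem ratBaseChange_twoVector [FiniteDimensional ℂ E] (hφ : ∀ q, φ (ExteriorAlgebra.ι ℚ q) = ExteriorAlgebra.ι ℂ (θ q))
    (hinl : ∀ i, θ (d (Sum.inl i)) = hatBasis c (Sum.inr i))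
    (hinr : ∀ i, θ (d (Sum.inr i)) = -hatBasis c (Sum.inl i)) :
    φ (twoVector d) = twoVector (hatBasis c) := by
  rw [twoVector, twoVector, map_sum]
  refine Finset.sum_congr rfl fun i _ ↦ ?_
  rw [map_mul, hφ, hφ, hinl, hinr, map_neg, mul_neg, eq_comm, eq_neg_iff_add_eq_zero]
  exact ExteriorAlgebra.ι_add_mul_swap _ _

/-- The complex basis `θ ∘ d = (f̂^*; -ê^*)` of `Alt¹_ℝ(E; ℂ)` (a signed re-indexing of the dual frame `ĉ`).
[cite: BourbakiAlgebre1a3, Ch. III §7 no. 8 Thm. 1] -/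
theorem exists_basis_eq_ratCovector [FiniteDimensional ℂ E] (hinl : ∀ i, θ (d (Sum.inl i)) = hatBasis c (Sum.inr i))
    (hinr : ∀ i, θ (d (Sum.inr i)) = -hatBasis c (Sum.inl i)) :
    ∃ c' : Basis (Fin g ⊕ Fin g) ℂ (E [⋀^Fin 1]→L[ℝ] ℂ), ∀ s, c' s = θ (d s) := by
  refine ⟨((hatBasis c).reindex (Equiv.sumComm (Fin g) (Fin g))).unitsSMul (Sum.elim (fun _ ↦ 1) (fun _ ↦ -1)),
    fun s ↦ ?_⟩
  rw [Basis.unitsSMul_apply, Basis.reindex_apply, Equiv.sumComm_symm, Equiv.sumComm_apply]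
  rcases s with i | i
  · rw [Sum.elim_inl, Sum.swap_inl, one_smul, hinl]
  · rw [Sum.elim_inr, Sum.swap_inr, Units.smul_def, Units.val_neg, Units.val_one, neg_one_smul, hinr]

/-- **`φ` in coordinates is the inclusion `ℚ ⊂ ℂ`**: `φ` carries the weight basis `(d_A)_A` of `⋀_ℚ ℚ^ι` to the
weight basis of the complex basis `c' = θ ∘ d` of `Alt¹`, so `φ(z) = Σ_A z_A · (c')_A` with the RATIONAL coordinates `z_A`
of `z` — the base change `⋀_ℚ ℚ^ι ⊗ ℂ ≅ ⋀_ℂ Alt¹` in coordinates. [cite: BourbakiAlgebre1a3, Ch. III §7 no. 8 Thm. 1 and no. 5 Prop. 8] -/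
theorem ratBaseChange_eq_sum_repr (hφ : ∀ q, φ (ExteriorAlgebra.ι ℚ q) = ExteriorAlgebra.ι ℂ (θ q))
    (c' : Basis (Fin g ⊕ Fin g) ℂ (E [⋀^Fin 1]→L[ℝ] ℂ)) (hc' : ∀ s, c' s = θ (d s)) (z : ExteriorAlgebra ℚ (ι → ℚ)) :
    φ z = ∑ A, (((weightBasis d).repr z A : ℚ) : ℂ) • weightBasis c' A := by
  classical
  have hw : ∀ A : Finset (Fin g ×ₗ Bool), φ (weightBasis d A) = weightBasis c' A := by
    intro A
    rw [weightBasis_apply d A rfl, weightBasis_apply c' A rfl, ratBaseChange_ιMulti hφ]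
    congr 1
    funext m
    rw [Function.comp_apply, Function.comp_apply, interleaved_apply, interleaved_apply, hc']
  conv_lhs => rw [← (weightBasis d).sum_repr z]
  rw [map_sum]
  refine Finset.sum_congr rfl fun A _ ↦ ?_
  rw [map_smul, hw, rat_smul_eq']

/-- **`φ` is injective.** [cite: BourbakiAlgebre1a3, Ch. III §7 no. 8 Thm. 1 and no. 5 Prop. 8] -/
theorem ratBaseChange_injective_of_basis (hφ : ∀ q, φ (ExteriorAlgebra.ι ℚ q) = ExteriorAlgebra.ι ℂ (θ q))
    (c' : Basis (Fin g ⊕ Fin g) ℂ (E [⋀^Fin 1]→L[ℝ] ℂ)) (hc' : ∀ s, c' s = θ (d s)) :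
    Function.Injective φ := by
  classical
  refine (injective_iff_map_eq_zero φ).2 fun z hz ↦ ?_
  rw [ratBaseChange_eq_sum_repr d hφ c' hc'] at hz
  have hc : ∀ A, (weightBasis d).repr z A = 0 := fun A ↦ by
    have h := linearIndependent_iff'.mp (weightBasis c').linearIndependent Finset.univ _ hz A (Finset.mem_univ A)
    exact_mod_cast h
  exact (weightBasis d).repr.map_eq_zero_iff.mp (Finsupp.ext hc)

/-- **`φ` carries `ℚ`-independent families to `ℂ`-independent families** (rational coordinate vectors independent
over `ℚ` stay independent over `ℂ`, Mathlib `linearIndependent_algebraMap_comp_iff`).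
[cite: BourbakiAlgebre1a3, Ch. III §7 no. 5 Prop. 8] -/
theorem ratBaseChange_linearIndependent (hφ : ∀ q, φ (ExteriorAlgebra.ι ℚ q) = ExteriorAlgebra.ι ℂ (θ q))
    (c' : Basis (Fin g ⊕ Fin g) ℂ (E [⋀^Fin 1]→L[ℝ] ℂ)) (hc' : ∀ s, c' s = θ (d s)) {κ : Type*}
    {v : κ → ExteriorAlgebra ℚ (ι → ℚ)} (hv : LinearIndependent ℚ v) : LinearIndependent ℂ fun k ↦ φ (v k) := by
  classical
  have h1 : LinearIndependent ℚ fun k ↦ ((weightBasis d).equivFun (v k) : Finset (Fin g ×ₗ Bool) → ℚ) :=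
    hv.map' (weightBasis d).equivFun.toLinearMap (LinearEquiv.ker _)
  have h2 := (linearIndependent_algebraMap_comp_iff (R := ℚ) (S := ℂ)).2 h1
  have h3 := h2.map' (weightBasis c').equivFun.symm.toLinearMap (LinearEquiv.ker _)
  have hfun : (fun k ↦ φ (v k)) =
      ⇑(weightBasis c').equivFun.symm.toLinearMap ∘ fun i ↦ ⇑(algebraMap ℚ ℂ) ∘ (weightBasis d).equivFun (v i) := by
    funext k
    rw [ratBaseChange_eq_sum_repr d hφ c' hc', Function.comp_apply, LinearEquiv.coe_toLinearMap,
      Basis.equivFun_symm_apply]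
    refine Finset.sum_congr rfl fun A _ ↦ ?_
    rw [Function.comp_apply, Basis.equivFun_apply, eq_ratCast]
  rw [hfun]
  exact h3

/-- **`φ(ω_d) = ω_{c'}`** for the complex basis `c' = θ ∘ d`. [cite: Lange2023AbelianVarietiesComplex, §7.3.2 (p. 338)] -/
theorem ratBaseChange_twoVector_eq (hφ : ∀ q, φ (ExteriorAlgebra.ι ℚ q) = ExteriorAlgebra.ι ℂ (θ q))
    (c' : Basis (Fin g ⊕ Fin g) ℂ (E [⋀^Fin 1]→L[ℝ] ℂ)) (hc' : ∀ s, c' s = θ (d s)) :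
    φ (twoVector d) = twoVector c' := by
  rw [twoVector, twoVector, map_sum]
  refine Finset.sum_congr rfl fun i _ ↦ ?_
  rw [map_mul, hφ, hφ, hc', hc']

/-- **`Ψ(φ(ω_Q)) = η`**: the `2`-vector `ω_Q ∈ ⋀² ℚ^ι` of the rational symplectic form is realised as the class of `η`
(`ω_Q = ω_d` for a Darboux basis, `φ(ω_d) = ω_ĉ`, and `Ψ(ω_ĉ) = η`, g17-#1 `extHom_twoVector_hatBasis`).
[cite: Lange2023AbelianVarietiesComplex, §7.3.2 (p. 338)] -/
theorem extHom_ratBaseChange_twoVectorOfForm [Fintype ι] [FiniteDimensional ℂ E]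
    (hnd : ∀ v : E, v ≠ 0 → ∃ w : E, η ![v, w] ≠ 0)
    (hQ : ∀ q q', ((Q q q' : ℚ) : ℝ) = η ![Φ (ratVec q), Φ (ratVec q')])
    (hθ : ∀ q v, θ q v = (η ![Φ (ratVec q), v 0] : ℂ))
    (hφ : ∀ q, φ (ExteriorAlgebra.ι ℚ q) = ExteriorAlgebra.ι ℂ (θ q)) :
    extHom (φ (twoVectorOfForm Q)) = of 2 (ofRealForm η) := by
  classical
  obtain ⟨B, -, -, hB⟩ := Literature.Geometry.Symplectic.exists_bilinForm_nondegenerate_eq_twoForm η hnd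
  obtain ⟨d, c, hll, hrr, hlr, hll', hrr', hlr', hc⟩ := exists_rat_darbouxBasis Φ hnd B hB hQ
  have hinl := ratCovector_darboux_inl Φ c d hθ hc hll' hlr'
  have hinr := ratCovector_darboux_inr Φ c d hθ hc hrr' hlr'
  rw [twoVectorOfForm_eq_twoVector (nondegenerate_of_ratCast_eq_twoForm Φ hnd B hB hQ) (isAlt_of_ratCast_eq_twoForm Φ hQ) d hll hrr hlr,
    ratBaseChange_twoVector c d hφ hinl hinr]
  exact extHom_twoVector_hatBasis c η hll' hrr' hlr'

/-- **`φ : ⋀_ℚ ℚ^ι → ⋀_ℂ Alt¹_ℝ(E; ℂ)` is injective.** [cite: BourbakiAlgebre1a3, Ch. III §7 no. 8 Thm. 1 and no. 5 Prop. 8] -/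
theorem ratBaseChange_injective [Fintype ι] [FiniteDimensional ℂ E] (hnd : ∀ v : E, v ≠ 0 → ∃ w : E, η ![v, w] ≠ 0)
    (hQ : ∀ q q', ((Q q q' : ℚ) : ℝ) = η ![Φ (ratVec q), Φ (ratVec q')])
    (hθ : ∀ q v, θ q v = (η ![Φ (ratVec q), v 0] : ℂ))
    (hφ : ∀ q, φ (ExteriorAlgebra.ι ℚ q) = ExteriorAlgebra.ι ℂ (θ q)) : Function.Injective φ := by
  classical
  obtain ⟨B, -, -, hB⟩ := Literature.Geometry.Symplectic.exists_bilinForm_nondegenerate_eq_twoForm η hnd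
  obtain ⟨d, c, -, -, -, hll', hrr', hlr', hc⟩ := exists_rat_darbouxBasis Φ hnd B hB hQ
  obtain ⟨c', hc'⟩ := exists_basis_eq_ratCovector c d (ratCovector_darboux_inl Φ c d hθ hc hll' hlr')
    (ratCovector_darboux_inr Φ c d hθ hc hrr' hlr')
  exact ratBaseChange_injective_of_basis d hφ c' hc'

end Darboux

/-! ## §4 `R(⋀ᵖ ℚ^ι) = Hᵖ(X, ℚ)` and §5 the theorem -/

section Main

variable {Q : LinearMap.BilinForm ℚ (ι → ℚ)} {θ : (ι → ℚ) →ₗ[ℚ] (E [⋀^Fin 1]→L[ℝ] ℂ)}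
  {φ : ExteriorAlgebra ℚ (ι → ℚ) →ₐ[ℚ] ExteriorAlgebra ℂ (E [⋀^Fin 1]→L[ℝ] ℂ)}

/-- **`θ` is injective** (`η` non-degenerate): `η(Φq, ·) = 0 ⇒ q = 0`. [cite: McDuffSalamon2017, §2.1 (symplectic vector spaces)] -/
theorem ratCovector_injective (hnd : ∀ v : E, v ≠ 0 → ∃ w : E, η ![v, w] ≠ 0)
    (hθ : ∀ q v, θ q v = (η ![Φ (ratVec q), v 0] : ℂ)) : Function.Injective θ := by
  refine (injective_iff_map_eq_zero θ).2 fun q hq ↦ ?_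
  by_contra hne
  have hv : Φ (ratVec q) ≠ 0 := by
    intro h
    apply hne
    have h0 : ratVec q = ratVec (0 : ι → ℚ) := by
      have h1 : ratVec q = 0 := Φ.injective (h.trans (map_zero Φ).symm)
      rw [h1]
      funext i
      rw [Pi.zero_apply, ratVec_apply, Pi.zero_apply, Rat.cast_zero]
    exact ratVec_injective h0
  obtain ⟨w, hw⟩ := hnd _ hv
  apply hw
  have h := hθ q ![w]
  rw [hq, ContinuousAlternatingMap.coe_zero, Pi.zero_apply, Matrix.cons_val_fin_one] at h
  exact_mod_cast h.symm

/-- **Every lattice coordinate covector `dx_a` is `θ` of a rational vector** (`θ` is injective of rank `|ι| = 2g` into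
`Span_ℚ {dx_a}`, which it lands in: `η(Φq, ·) = Σ_a η(Φq, Φe_a) dx_a` with rational coefficients).
[cite: Lange2023AbelianVarietiesComplex, §1.1.4 Prop. 1.1.20, §1.2.2 Prop. 1.2.9] -/
theorem exists_ratCovector_eq_hat_coord [Fintype ι] [DecidableEq ι] [FiniteDimensional ℂ E]
    (hnd : ∀ v : E, v ≠ 0 → ∃ w : E, η ![v, w] ≠ 0)
    (hQ : ∀ q q', ((Q q q' : ℚ) : ℝ) = η ![Φ (ratVec q), Φ (ratVec q')])
    (hθ : ∀ q v, θ q v = (η ![Φ (ratVec q), v 0] : ℂ)) (a : ι) :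
    ∃ q : ι → ℚ, θ q = hat (coord Φ a) := by
  -- `θ` lands in the `ℚ`-span `S` of the coordinate covectors
  set S : Submodule ℚ (E [⋀^Fin 1]→L[ℝ] ℂ) := Submodule.span ℚ (Set.range fun a ↦ hat (coord Φ a)) with hS
  let bE : Basis ι ℝ E := (Pi.basisFun ℝ ι).map Φ.toLinearEquiv
  have hbE : ∀ l, bE l = Φ (Pi.single l 1) := fun l ↦ by
    show Φ.toLinearEquiv (Pi.basisFun ℝ ι l) = _
    rw [Pi.basisFun_apply]
    rfl
  have hθS : ∀ q, θ q ∈ S := by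
    intro q
    have hq : θ q = ∑ a, Q q (Pi.single a 1) • hat (coord Φ a) := by
      refine oneForm_eq_of_apply_basis bE fun l ↦ ?_
      rw [hθ, Matrix.cons_val_zero, hbE, ContinuousAlternatingMap.sum_apply,
        Finset.sum_eq_single l (fun a _ hal ↦ ?_) (fun h ↦ absurd (Finset.mem_univ l) h)]
      · rw [ContinuousAlternatingMap.smul_apply, hat_apply, Matrix.cons_val_zero, coord_dual, if_pos rfl,
          Complex.ofReal_one, Rat.smul_one_eq_cast, ← ratVec_single' l, ← hQ, Complex.ofReal_ratCast]
      · rw [ContinuousAlternatingMap.smul_apply, hat_apply, Matrix.cons_val_zero, coord_dual, if_neg hal,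
          Complex.ofReal_zero, smul_zero]
    rw [hq]
    exact Submodule.sum_mem _ fun a _ ↦ Submodule.smul_mem _ _ (Submodule.subset_span ⟨a, rfl⟩)
  -- `θ` is injective of rank `|ι|`, `dim_ℚ S ≤ |ι|`: `range θ = S`
  have hinj := ratCovector_injective Φ hnd hθ
  have hle : LinearMap.range θ ≤ S := by
    rintro _ ⟨q, rfl⟩
    exact hθS q
  haveI : FiniteDimensional ℚ S := FiniteDimensional.span_of_finite ℚ (Set.finite_range _)
  have hfin : finrank ℚ S ≤ finrank ℚ (LinearMap.range θ) := by
    rw [LinearMap.finrank_range_of_inj hinj, Module.finrank_fintype_fun_eq_card]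
    exact finrank_range_le_card _
  have heq : LinearMap.range θ = S := Submodule.eq_of_le_of_finrank_le hle hfin
  have ha : hat (coord Φ a) ∈ LinearMap.range θ := by
    rw [heq]
    exact Submodule.subset_span ⟨a, rfl⟩
  obtain ⟨q, hq⟩ := ha
  exact ⟨q, hq⟩

/-- **`Hᵖ(X, ℚ) ⊆ R(⋀ᵖ ℚ^ι)`**: every rational `p`-class is the realisation of a rational `p`-vector — the lattice
monomials `dx_{w₀} ∧ ⋯ ∧ dx_{w_{p-1}}`, which span `Hᵖ(X, ℚ)` over `ℚ` (Lange Prop. 1.1.20, tree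
`rationalForms_eq_span_latMonomial`), are `R(q_{w₀} ∧ ⋯ ∧ q_{w_{p-1}})` for `θ(q_a) = dx_a`.
[cite: Lange2023AbelianVarietiesComplex, §1.1.3 Cor. 1.1.19, §1.1.4 Prop. 1.1.20] -/
theorem exists_ratRealize_eq_of_mem_rationalForms [Fintype ι] [FiniteDimensional ℂ E]
    (hnd : ∀ v : E, v ≠ 0 → ∃ w : E, η ![v, w] ≠ 0)
    (hQ : ∀ q q', ((Q q q' : ℚ) : ℝ) = η ![Φ (ratVec q), Φ (ratVec q')])
    (hθ : ∀ q v, θ q v = (η ![Φ (ratVec q), v 0] : ℂ))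
    (hφ : ∀ q, φ (ExteriorAlgebra.ι ℚ q) = ExteriorAlgebra.ι ℂ (θ q)) {p : ℕ}
    {R : ExteriorAlgebra ℚ (ι → ℚ) →ₗ[ℚ] (E [⋀^Fin p]→L[ℝ] ℂ)} (hR : ∀ y, R y = extHom (φ y) p)
    {x : E [⋀^Fin p]→L[ℝ] ℂ} (hx : x ∈ rationalForms Φ p) : ∃ y ∈ ⋀[ℚ]^p (ι → ℚ), R y = x := by
  classical
  choose qv hqv using exists_ratCovector_eq_hat_coord Φ hnd hQ hθ
  -- the lattice monomials are realised
  have hmono : ∀ w : Fin p → ι, R (ExteriorAlgebra.ιMulti ℚ p fun j ↦ qv (w j)) = latMonomial Φ p w := by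
    intro w
    rw [hR, ratBaseChange_ιMulti hφ]
    have h : (fun i ↦ θ (qv (w i))) = fun i ↦ hat (coord Φ (w i)) := funext fun i ↦ hqv (w i)
    rw [h, extHom_ιMulti_hat (coord Φ) p w, of_apply_self, latMonomial_eq]
  letI : LinearOrder ι := LinearOrder.lift' (Fintype.equivFin ι) (Fintype.equivFin ι).injective
  rw [rationalForms_eq_span_latMonomial] at hx
  induction hx using Submodule.span_induction with
  | mem x h =>
    obtain ⟨w, rfl⟩ := h
    exact ⟨_, ExteriorAlgebra.ιMulti_range ℚ p ⟨_, rfl⟩, hmono w⟩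
  | zero => exact ⟨0, Submodule.zero_mem _, map_zero R⟩
  | add x y _ _ hx hy =>
    obtain ⟨a, ha, rfl⟩ := hx
    obtain ⟨b, hb, rfl⟩ := hy
    exact ⟨a + b, Submodule.add_mem _ ha hb, map_add R a b⟩
  | smul r x _ hx =>
    obtain ⟨a, ha, rfl⟩ := hx
    exact ⟨r • a, Submodule.smul_mem _ r ha, map_smul R r a⟩

/-- **`R(⋀ᵖ ℚ^ι) = Hᵖ(X, ℚ)`**: the degree-`p` realisation maps the rational `p`-vectors onto the rational
`p`-classes (`Hᵖ(X, ℚ) = ⋀ᵖ Hom(Λ, ℚ)`, Lange Cor. 1.1.19, realised inside `Hᵖ(X, ℂ)` through `η`).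
[cite: Lange2023AbelianVarietiesComplex, §1.1.3 Cor. 1.1.19, §1.1.4 Prop. 1.1.20] -/
theorem map_ratRealize_exteriorPower_eq_rationalForms [Fintype ι] [FiniteDimensional ℂ E]
    (hnd : ∀ v : E, v ≠ 0 → ∃ w : E, η ![v, w] ≠ 0)
    (hQ : ∀ q q', ((Q q q' : ℚ) : ℝ) = η ![Φ (ratVec q), Φ (ratVec q')])
    (hθ : ∀ q v, θ q v = (η ![Φ (ratVec q), v 0] : ℂ))
    (hφ : ∀ q, φ (ExteriorAlgebra.ι ℚ q) = ExteriorAlgebra.ι ℂ (θ q)) {p : ℕ}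
    {R : ExteriorAlgebra ℚ (ι → ℚ) →ₗ[ℚ] (E [⋀^Fin p]→L[ℝ] ℂ)} (hR : ∀ y, R y = extHom (φ y) p) :
    (⋀[ℚ]^p (ι → ℚ)).map R = rationalForms Φ p := by
  refine le_antisymm ?_ fun x hx ↦ ?_
  · rintro _ ⟨y, hy, rfl⟩
    exact ratRealize_mem_rationalForms Φ hQ hθ hφ hR hy
  · obtain ⟨y, hy, rfl⟩ := exists_ratRealize_eq_of_mem_rationalForms Φ hnd hQ hθ hφ hR hx
    exact Submodule.mem_map_of_mem hy

/-- **`y ∈ Pᵖ(ω_Q) ↔ R y ∈ Pᵖ(η)`** for a rational `p`-vector `y`: the realisation matches Lange's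
`Pᵖ = ker L^{g-p+1}` on the two carriers (`φ` injective and multiplicative, `Ψ(φ(ω_Q)) = η`, g17-#1
`mem_primitive_iff_extPiece_mem`). [cite: Lange2023AbelianVarietiesComplex, §7.3.2 (p. 338)] -/
theorem mem_primitive_iff_ratRealize_mem [Fintype ι] [FiniteDimensional ℂ E]
    (hnd : ∀ v : E, v ≠ 0 → ∃ w : E, η ![v, w] ≠ 0)
    (hQ : ∀ q q', ((Q q q' : ℚ) : ℝ) = η ![Φ (ratVec q), Φ (ratVec q')])
    (hθ : ∀ q v, θ q v = (η ![Φ (ratVec q), v 0] : ℂ))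
    (hφ : ∀ q, φ (ExteriorAlgebra.ι ℚ q) = ExteriorAlgebra.ι ℂ (θ q)) {p : ℕ}
    {R : ExteriorAlgebra ℚ (ι → ℚ) →ₗ[ℚ] (E [⋀^Fin p]→L[ℝ] ℂ)} (hR : ∀ y, R y = extHom (φ y) p)
    {y : ExteriorAlgebra ℚ (ι → ℚ)} (hy : y ∈ ⋀[ℚ]^p (ι → ℚ)) :
    y ∈ primitive (twoVectorOfForm Q) (finrank ℂ E) p ↔ R y ∈ primitiveForms η p := by
  have hinj := ratBaseChange_injective Φ hnd hQ hθ hφ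
  have hω := extHom_ratBaseChange_twoVectorOfForm Φ hnd hQ hθ hφ
  have hω2 : φ (twoVectorOfForm Q) ∈ ⋀[ℂ]^2 (E [⋀^Fin 1]→L[ℝ] ℂ) :=
    ratBaseChange_mem_exteriorPower hφ (twoVectorOfForm_mem Q)
  have hφy : φ y ∈ ⋀[ℂ]^p (E [⋀^Fin 1]→L[ℝ] ℂ) := ratBaseChange_mem_exteriorPower hφ hy
  have key := mem_primitive_iff_extPiece_mem η hω2 hω ⟨φ y, hφy⟩
  have hRy : R y = extPiece p ⟨φ y, hφy⟩ := by rw [hR, extPiece_apply]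
  rw [hRy, ← key, mem_primitive_iff, mem_primitive_iff]
  simp only [hy, hφy, true_and]
  rw [← map_pow, ← map_mul]
  exact ⟨fun h ↦ by rw [h, map_zero], fun h ↦ hinj (by rw [h, map_zero])⟩

/-- **`R(Pᵖ(ω_Q)) = Pᵖ(η) ∩ Hᵖ(X, ℚ)`**: the realisation identifies the primitive `p`-vectors of the rational
symplectic space `(ℚ^ι, Q) = (Λ_ℚ, η)` with the rational primitive `p`-classes of `X`.
[cite: Lange2023AbelianVarietiesComplex, §7.3.2 (p. 338), §1.1.3 Cor. 1.1.19] -/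
theorem map_ratRealize_primitive_eq [Fintype ι] [FiniteDimensional ℂ E]
    (hnd : ∀ v : E, v ≠ 0 → ∃ w : E, η ![v, w] ≠ 0)
    (hQ : ∀ q q', ((Q q q' : ℚ) : ℝ) = η ![Φ (ratVec q), Φ (ratVec q')])
    (hθ : ∀ q v, θ q v = (η ![Φ (ratVec q), v 0] : ℂ))
    (hφ : ∀ q, φ (ExteriorAlgebra.ι ℚ q) = ExteriorAlgebra.ι ℂ (θ q)) {p : ℕ}
    {R : ExteriorAlgebra ℚ (ι → ℚ) →ₗ[ℚ] (E [⋀^Fin p]→L[ℝ] ℂ)} (hR : ∀ y, R y = extHom (φ y) p) :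
    (primitive (twoVectorOfForm Q) (finrank ℂ E) p).map R =
      (primitiveForms η p).restrictScalars ℚ ⊓ rationalForms Φ p := by
  refine le_antisymm ?_ fun x hx ↦ ?_
  · rintro _ ⟨y, hy, rfl⟩
    have hy' : y ∈ ⋀[ℚ]^p (ι → ℚ) := (mem_primitive_iff.mp hy).1
    exact Submodule.mem_inf.mpr ⟨(mem_primitive_iff_ratRealize_mem Φ hnd hQ hθ hφ hR hy').1 hy,
      ratRealize_mem_rationalForms Φ hQ hθ hφ hR hy'⟩
  · rw [Submodule.mem_inf, Submodule.restrictScalars_mem] at hx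
    obtain ⟨y, hy, rfl⟩ := exists_ratRealize_eq_of_mem_rationalForms Φ hnd hQ hθ hφ hR hx.2
    exact Submodule.mem_map_of_mem ((mem_primitive_iff_ratRealize_mem Φ hnd hQ hθ hφ hR hy).2 hx.1)

/-- **Goodman–Wallach, Prop. 5.5.18 over `ℚ`, on the complex torus — the rational primitive classes are spanned by
the determinant classes of the isotropic rational frames.** For a complex torus `X = E/Λ` (`Λ = Φ(ℤ^ι)`), a
non-degenerate `η ∈ NS(X)` (`IsNSForm Φ η`: type `(1,1)`, integral on `Λ`), `g = dim_ℂ E` and `p ≤ g`: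
`Pᵖ(η) ∩ Hᵖ(X, ℚ) = Span_ℚ { x ↦ det (η(Φqᵢ, xⱼ))ᵢⱼ : q₀, …, q_{p-1} ∈ ℚ^ι, η(Φqᵢ, Φqⱼ) = 0 }` — the `ℚ`-span of
the classes `η(a₀, ·) ∧ ⋯ ∧ η(a_{p-1}, ·)`, `aᵢ ∈ Λ_ℚ` pairwise `η`-orthogonal. Proof: Prop. 5.5.18 over the FIELD `ℚ`
(FILE 1 `span_ιMulti_isotropic_eq_primitive`, `K = ℚ`, `W = ℚ^ι = Λ_ℚ`, `Q = η|_{Λ_ℚ}`) transported along the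
injective multiplicative realisation `R` (`map_ratRealize_primitive_eq`, `ratRealize_ιMulti_apply`); `⊇` by g23-#1
`det_twoForm_mem_primitiveForms` and the rationality of the periods.
[cite: GoodmanWallachGTM255, §5.5.2 Prop. 5.5.18] [cite: Lange2023AbelianVarietiesComplex, §7.3.2 (p. 338); §1.1.3 Cor. 1.1.19; §1.2.2 Prop. 1.2.9] -/
theorem primitiveForms_restrictScalars_inf_rationalForms_eq_span [Fintype ι] [FiniteDimensional ℂ E]
    (hη : IsNSForm Φ η) (hnd : ∀ v : E, v ≠ 0 → ∃ w : E, η ![v, w] ≠ 0) {p : ℕ} (hp : p ≤ finrank ℂ E) :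
    (primitiveForms η p).restrictScalars ℚ ⊓ rationalForms Φ p =
      Submodule.span ℚ {ψ : E [⋀^Fin p]→L[ℝ] ℂ | ∃ q : Fin p → ι → ℚ,
        (∀ i j, η ![Φ (ratVec (q i)), Φ (ratVec (q j))] = 0) ∧
        ∀ x : Fin p → E, ψ x = (Matrix.of fun i j ↦ (η ![Φ (ratVec (q i)), x j] : ℂ)).det} := by
  classical
  obtain ⟨B, -, -, hB⟩ := Literature.Geometry.Symplectic.exists_bilinForm_nondegenerate_eq_twoForm η hnd
  obtain ⟨Q, hQ⟩ := hη.exists_bilinForm_rat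
  obtain ⟨θ, hθ⟩ := exists_ratCovector Φ (η := η) B hB
  obtain ⟨φ, hφ⟩ := exists_ratBaseChange θ
  obtain ⟨R, hR⟩ := exists_ratRealize φ p
  have hA := isAlt_of_ratCast_eq_twoForm Φ hQ
  have hN := nondegenerate_of_ratCast_eq_twoForm Φ hnd B hB hQ
  refine le_antisymm ?_ (Submodule.span_le.mpr ?_)
  · intro x hx
    rw [Submodule.mem_inf, Submodule.restrictScalars_mem] at hx
    obtain ⟨y, hy, rfl⟩ := exists_ratRealize_eq_of_mem_rationalForms Φ hnd hQ hθ hφ hR hx.2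
    have hyP : y ∈ primitive (twoVectorOfForm Q) (finrank ℂ E) p :=
      (mem_primitive_iff_ratRealize_mem Φ hnd hQ hθ hφ hR hy).2 hx.1
    rw [← span_ιMulti_isotropic_eq_primitive hN hA (finrank_ratFun_eq_two_mul_finrank Φ) hp] at hyP
    clear hx hy
    induction hyP using Submodule.span_induction with
    | mem z h =>
      obtain ⟨m, hm, rfl⟩ := h
      refine Submodule.subset_span ⟨m, fun i j ↦ ?_, fun x ↦ ratRealize_ιMulti_apply Φ hθ hφ hR m x⟩
      rw [← hQ, hm i j, Rat.cast_zero]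
    | zero =>
      rw [map_zero]
      exact Submodule.zero_mem _
    | add z z' _ _ hz hz' =>
      rw [map_add]
      exact Submodule.add_mem _ hz hz'
    | smul a z _ hz =>
      rw [map_smul]
      exact Submodule.smul_mem _ a hz
  · rintro ψ ⟨q, hq, hψ⟩
    have hψR : ψ = R (ExteriorAlgebra.ιMulti ℚ p q) := by
      ext x
      rw [hψ, ratRealize_ιMulti_apply Φ hθ hφ hR]
    refine Submodule.mem_inf.mpr ⟨?_, ?_⟩
    · rw [Submodule.restrictScalars_mem]
      exact det_twoForm_mem_primitiveForms hnd (fun i ↦ Φ (ratVec (q i))) hq hψ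
    · rw [hψR]
      exact ratRealize_mem_rationalForms Φ hQ hθ hφ hR (ExteriorAlgebra.ιMulti_range ℚ p ⟨q, rfl⟩)

/-- **Membership form**: a primitive `p`-form with rational periods (`p ≤ dim_ℂ E`, `η ∈ NS(X)` non-degenerate) is a
`ℚ`-linear combination of determinant forms of `η`-isotropic rational `p`-frames.
[cite: GoodmanWallachGTM255, §5.5.2 Prop. 5.5.18] [cite: Lange2023AbelianVarietiesComplex, §7.3.2 (p. 338)] -/
theorem mem_span_rat_det_twoForm_of_mem_primitiveForms [Fintype ι] [FiniteDimensional ℂ E]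
    (hη : IsNSForm Φ η) (hnd : ∀ v : E, v ≠ 0 → ∃ w : E, η ![v, w] ≠ 0) {p : ℕ} (hp : p ≤ finrank ℂ E)
    {ψ : E [⋀^Fin p]→L[ℝ] ℂ} (hP : ψ ∈ primitiveForms η p) (hQ : ψ ∈ rationalForms Φ p) :
    ψ ∈ Submodule.span ℚ {ψ : E [⋀^Fin p]→L[ℝ] ℂ | ∃ q : Fin p → ι → ℚ,
        (∀ i j, η ![Φ (ratVec (q i)), Φ (ratVec (q j))] = 0) ∧
        ∀ x : Fin p → E, ψ x = (Matrix.of fun i j ↦ (η ![Φ (ratVec (q i)), x j] : ℂ)).det} := by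
  rw [← primitiveForms_restrictScalars_inf_rationalForms_eq_span Φ hη hnd hp]
  exact Submodule.mem_inf.mpr ⟨hP, hQ⟩

/-- **The generators are rational primitive classes**: the determinant form of an `η`-isotropic rational `p`-frame
lies in `Pᵖ(η) ∩ Hᵖ(X, ℚ)` (any `p`; `η ∈ NS(X)` non-degenerate).
[cite: GoodmanWallachGTM255, §5.5.2 Prop. 5.5.18 (proof, "`F_p ⊂ H`")] [cite: Lange2023AbelianVarietiesComplex, §1.2.2 Prop. 1.2.9] -/
theorem det_twoForm_ratVec_mem [Fintype ι] [FiniteDimensional ℂ E]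
    (hη : IsNSForm Φ η) (hnd : ∀ v : E, v ≠ 0 → ∃ w : E, η ![v, w] ≠ 0) {p : ℕ} (q : Fin p → ι → ℚ)
    (hq : ∀ i j, η ![Φ (ratVec (q i)), Φ (ratVec (q j))] = 0) {ψ : E [⋀^Fin p]→L[ℝ] ℂ}
    (hψ : ∀ x : Fin p → E, ψ x = (Matrix.of fun i j ↦ (η ![Φ (ratVec (q i)), x j] : ℂ)).det) :
    ψ ∈ primitiveForms η p ∧ ψ ∈ rationalForms Φ p := by
  obtain ⟨B, -, -, hB⟩ := Literature.Geometry.Symplectic.exists_bilinForm_nondegenerate_eq_twoForm η hnd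
  obtain ⟨Q, hQ⟩ := hη.exists_bilinForm_rat
  obtain ⟨θ, hθ⟩ := exists_ratCovector Φ (η := η) B hB
  obtain ⟨φ, hφ⟩ := exists_ratBaseChange θ
  obtain ⟨R, hR⟩ := exists_ratRealize φ p
  have hψR : ψ = R (ExteriorAlgebra.ιMulti ℚ p q) := by
    ext x
    rw [hψ, ratRealize_ιMulti_apply Φ hθ hφ hR]
  refine ⟨det_twoForm_mem_primitiveForms hnd (fun i ↦ Φ (ratVec (q i))) hq hψ, ?_⟩
  rw [hψR]
  exact ratRealize_mem_rationalForms Φ hQ hθ hφ hR (ExteriorAlgebra.ιMulti_range ℚ p ⟨q, rfl⟩)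

end Main

/-! ## §6 The complex span: `Pᵖ(η)` itself is spanned by the RATIONAL isotropic determinant classes -/

section ComplexSpan

variable {Q : LinearMap.BilinForm ℚ (ι → ℚ)} {θ : (ι → ℚ) →ₗ[ℚ] (E [⋀^Fin 1]→L[ℝ] ℂ)}
  {φ : ExteriorAlgebra ℚ (ι → ℚ) →ₐ[ℚ] ExteriorAlgebra ℂ (E [⋀^Fin 1]→L[ℝ] ℂ)}

/-- **`Span_ℂ φ(isotropic rational p-vectors) = Pᵖ(φ(ω_Q))` in `⋀_ℂ Alt¹_ℝ(E; ℂ)`**: the complex primitive space of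
the realised `2`-vector is spanned over `ℂ` by the images of the `Q`-isotropic rational `p`-vectors (`p ≤ g`).
`⊆`: `φ` maps `Pᵖ(ω_Q)` into `Pᵖ(φ ω_Q)` (multiplicativity); `⊇` by dimensions: `dim_ℂ Pᵖ(φ ω_Q) = dim_ℚ Pᵖ(ω_Q)`
(`φ ω_Q = ω_{c'}` for the complex Darboux basis `c' = θ ∘ d`; `finrank_primitive_twoVector_add_ite` for both fields) and
`φ` carries a `ℚ`-basis of `Pᵖ(ω_Q) = Span_ℚ{isotropic p-vectors}` (FILE 1) to a `ℂ`-independent family in the span.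
[cite: GoodmanWallachGTM255, §5.5.2 Prop. 5.5.18, Cor. 5.5.17] [cite: BourbakiAlgebre1a3, Ch. III §7 no. 5 Prop. 8] -/
theorem span_ratBaseChange_ιMulti_isotropic_eq_primitive [Fintype ι] [FiniteDimensional ℂ E]
    (hnd : ∀ v : E, v ≠ 0 → ∃ w : E, η ![v, w] ≠ 0)
    (hQ : ∀ q q', ((Q q q' : ℚ) : ℝ) = η ![Φ (ratVec q), Φ (ratVec q')])
    (hθ : ∀ q v, θ q v = (η ![Φ (ratVec q), v 0] : ℂ))
    (hφ : ∀ q, φ (ExteriorAlgebra.ι ℚ q) = ExteriorAlgebra.ι ℂ (θ q)) {p : ℕ} (hp : p ≤ finrank ℂ E) :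
    Submodule.span ℂ {x : ExteriorAlgebra ℂ (E [⋀^Fin 1]→L[ℝ] ℂ) | ∃ m : Fin p → ι → ℚ,
        (∀ i j, Q (m i) (m j) = 0) ∧ x = φ (ExteriorAlgebra.ιMulti ℚ p m)} =
      primitive (φ (twoVectorOfForm Q)) (finrank ℂ E) p := by
  classical
  obtain ⟨B, -, -, hB⟩ := Literature.Geometry.Symplectic.exists_bilinForm_nondegenerate_eq_twoForm η hnd
  have hA := isAlt_of_ratCast_eq_twoForm Φ hQ
  have hN := nondegenerate_of_ratCast_eq_twoForm Φ hnd B hB hQ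
  have hg := finrank_ratFun_eq_two_mul_finrank Φ
  obtain ⟨d, c, hll, hrr, hlr, hll', hrr', hlr', hc⟩ := exists_rat_darbouxBasis Φ hnd B hB hQ
  obtain ⟨c', hc'⟩ := exists_basis_eq_ratCovector c d (ratCovector_darboux_inl Φ c d hθ hc hll' hlr')
    (ratCovector_darboux_inr Φ c d hθ hc hrr' hlr')
  have hωd : twoVectorOfForm Q = twoVector d := twoVectorOfForm_eq_twoVector hN hA d hll hrr hlr
  have hω' : φ (twoVectorOfForm Q) = twoVector c' := by rw [hωd, ratBaseChange_twoVector_eq d hφ c' hc']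
  -- `φ` maps the rational span into the complex primitive space
  have hmap : ∀ z ∈ Submodule.span ℚ {x : ExteriorAlgebra ℚ (ι → ℚ) | ∃ v : Fin p → ι → ℚ,
      (∀ i j, Q (v i) (v j) = 0) ∧ x = ExteriorAlgebra.ιMulti ℚ p v},
      φ z ∈ Submodule.span ℂ {x : ExteriorAlgebra ℂ (E [⋀^Fin 1]→L[ℝ] ℂ) | ∃ m : Fin p → ι → ℚ,
        (∀ i j, Q (m i) (m j) = 0) ∧ x = φ (ExteriorAlgebra.ιMulti ℚ p m)} := by
    intro z hz
    induction hz using Submodule.span_induction with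
    | mem z h =>
      obtain ⟨m, hm, rfl⟩ := h
      exact Submodule.subset_span ⟨m, hm, rfl⟩
    | zero =>
      rw [map_zero]
      exact Submodule.zero_mem _
    | add z z' _ _ hz hz' =>
      rw [map_add]
      exact Submodule.add_mem _ hz hz'
    | smul a z _ hz =>
      rw [map_smul, rat_smul_eq']
      exact Submodule.smul_mem _ _ hz
  have hle : Submodule.span ℂ {x : ExteriorAlgebra ℂ (E [⋀^Fin 1]→L[ℝ] ℂ) | ∃ m : Fin p → ι → ℚ,
        (∀ i j, Q (m i) (m j) = 0) ∧ x = φ (ExteriorAlgebra.ιMulti ℚ p m)} ≤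
      primitive (φ (twoVectorOfForm Q)) (finrank ℂ E) p := by
    refine Submodule.span_le.mpr ?_
    rintro _ ⟨m, hm, rfl⟩
    have hmem := ιMulti_mem_primitive_of_isotropic hN hA hg m hm
    rw [SetLike.mem_coe, mem_primitive_iff]
    rw [mem_primitive_iff] at hmem
    refine ⟨ratBaseChange_mem_exteriorPower hφ hmem.1, ?_⟩
    rw [← map_pow, ← map_mul, hmem.2, map_zero]
  haveI : FiniteDimensional ℂ (ExteriorAlgebra ℂ (E [⋀^Fin 1]→L[ℝ] ℂ)) := Module.Finite.of_basis (weightBasis c')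
  haveI : FiniteDimensional ℚ (ExteriorAlgebra ℚ (ι → ℚ)) := Module.Finite.of_basis (weightBasis d)
  refine Submodule.eq_of_le_of_finrank_le hle ?_
  -- a `ℚ`-basis of `Pᵖ(ω_Q)` realised as a `ℂ`-independent family in the span
  set Pq := primitive (twoVectorOfForm Q) (finrank ℂ E) p with hPq
  let bP := Module.finBasis ℚ Pq
  have hv : LinearIndependent ℚ fun k ↦ (bP k : ExteriorAlgebra ℚ (ι → ℚ)) :=
    bP.linearIndependent.map' Pq.subtype (Submodule.ker_subtype Pq)
  have hvC := ratBaseChange_linearIndependent d hφ c' hc' hv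
  have hmemS : ∀ k, φ (bP k : ExteriorAlgebra ℚ (ι → ℚ)) ∈ Submodule.span ℂ {x : ExteriorAlgebra ℂ (E [⋀^Fin 1]→L[ℝ] ℂ) |
      ∃ m : Fin p → ι → ℚ, (∀ i j, Q (m i) (m j) = 0) ∧ x = φ (ExteriorAlgebra.ιMulti ℚ p m)} := by
    intro k
    have hk : (bP k : ExteriorAlgebra ℚ (ι → ℚ)) ∈ Submodule.span ℚ {x : ExteriorAlgebra ℚ (ι → ℚ) |
        ∃ v : Fin p → ι → ℚ, (∀ i j, Q (v i) (v j) = 0) ∧ x = ExteriorAlgebra.ιMulti ℚ p v} := by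
      rw [span_ιMulti_isotropic_eq_primitive hN hA hg hp]
      exact (bP k).2
    exact hmap _ hk
  have hli : LinearIndependent ℂ fun k ↦ (⟨φ (bP k : ExteriorAlgebra ℚ (ι → ℚ)), hmemS k⟩ :
      Submodule.span ℂ {x : ExteriorAlgebra ℂ (E [⋀^Fin 1]→L[ℝ] ℂ) | ∃ m : Fin p → ι → ℚ,
        (∀ i j, Q (m i) (m j) = 0) ∧ x = φ (ExteriorAlgebra.ιMulti ℚ p m)}) :=
    LinearIndependent.of_comp (Submodule.subtype _) hvC
  have hdim : finrank ℂ (primitive (φ (twoVectorOfForm Q)) (finrank ℂ E) p) = finrank ℚ Pq := by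
    rw [hω', hPq, hωd]
    have h1 := finrank_primitive_twoVector_add_ite c' hp
    have h2 := finrank_primitive_twoVector_add_ite d hp
    exact Nat.add_right_cancel (h1.trans h2.symm)
  calc finrank ℂ (primitive (φ (twoVectorOfForm Q)) (finrank ℂ E) p)
      = Fintype.card (Fin (finrank ℚ Pq)) := by rw [hdim, Fintype.card_fin]
    _ ≤ _ := hli.fintype_card_le_finrank

/-- **`Pᵖ(η)` is spanned over `ℂ` by the determinant classes of the `η`-isotropic RATIONAL `p`-frames**
(`η ∈ NS(X)` non-degenerate, `p ≤ g`):
`Pᵖ(η) = Span_ℂ { x ↦ det (η(Φqᵢ, xⱼ))ᵢⱼ : q₀, …, q_{p-1} ∈ ℚ^ι, η(Φqᵢ, Φqⱼ) = 0 }` — Goodman–Wallach's Prop. 5.5.18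
on the torus (g23-#1, REAL frames) with generators that are rational classes; equivalently `Pᵖ(η)` is defined over
`ℚ` and `Pᵖ(η) ∩ Hᵖ(X, ℚ)` (described in `primitiveForms_restrictScalars_inf_rationalForms_eq_span`) spans it over `ℂ`.
Proof: `Pᵖ(η) = Ψ_p(Pᵖ(φ ω_Q))` (g17-#1 `mem_primitive_iff_extPiece_mem`, `Ψ(φ ω_Q) = η`) and
`span_ratBaseChange_ιMulti_isotropic_eq_primitive`; `⊇` by g23-#1 `det_twoForm_mem_primitiveForms`.
[cite: GoodmanWallachGTM255, §5.5.2 Prop. 5.5.18] [cite: Lange2023AbelianVarietiesComplex, §7.3.2 (p. 338); §1.2.2 Prop. 1.2.9] -/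
theorem primitiveForms_eq_span_det_twoForm_ratVec [Fintype ι] [FiniteDimensional ℂ E]
    (hη : IsNSForm Φ η) (hnd : ∀ v : E, v ≠ 0 → ∃ w : E, η ![v, w] ≠ 0) {p : ℕ} (hp : p ≤ finrank ℂ E) :
    primitiveForms η p = Submodule.span ℂ {ψ : E [⋀^Fin p]→L[ℝ] ℂ | ∃ q : Fin p → ι → ℚ,
        (∀ i j, η ![Φ (ratVec (q i)), Φ (ratVec (q j))] = 0) ∧
        ∀ x : Fin p → E, ψ x = (Matrix.of fun i j ↦ (η ![Φ (ratVec (q i)), x j] : ℂ)).det} := by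
  classical
  obtain ⟨B, -, -, hB⟩ := Literature.Geometry.Symplectic.exists_bilinForm_nondegenerate_eq_twoForm η hnd
  obtain ⟨Q, hQ⟩ := hη.exists_bilinForm_rat
  obtain ⟨θ, hθ⟩ := exists_ratCovector Φ (η := η) B hB
  obtain ⟨φ, hφ⟩ := exists_ratBaseChange θ
  obtain ⟨R, hR⟩ := exists_ratRealize φ p
  refine le_antisymm (fun x hx ↦ ?_) (Submodule.span_le.mpr ?_)
  · have hω := extHom_ratBaseChange_twoVectorOfForm Φ hnd hQ hθ hφ
    have hω2 : φ (twoVectorOfForm Q) ∈ ⋀[ℂ]^2 (E [⋀^Fin 1]→L[ℝ] ℂ) :=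
      ratBaseChange_mem_exteriorPower hφ (twoVectorOfForm_mem Q)
    obtain ⟨y, rfl⟩ := (extPiece_bijective p).2 x
    have hy : (y : ExteriorAlgebra ℂ (E [⋀^Fin 1]→L[ℝ] ℂ)) ∈ primitive (φ (twoVectorOfForm Q)) (finrank ℂ E) p :=
      (mem_primitive_iff_extPiece_mem η hω2 hω y).2 hx
    rw [← span_ratBaseChange_ιMulti_isotropic_eq_primitive Φ hnd hQ hθ hφ hp] at hy
    -- the `ℂ`-linear `z ↦ Ψ(z)_p`
    let Rc : ExteriorAlgebra ℂ (E [⋀^Fin 1]→L[ℝ] ℂ) →ₗ[ℂ] (E [⋀^Fin p]→L[ℝ] ℂ) :=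
      (LinearMap.proj p : Literature.LinearAlgebra.Alternating.GForm E ℂ →ₗ[ℂ] (E [⋀^Fin p]→L[ℝ] ℂ)) ∘ₗ
        (extHom (E := E)).toLinearMap
    have hRc : ∀ z, Rc z = extHom z p := fun z ↦ rfl
    have hx' : extPiece p y = Rc y := by rw [hRc, extPiece_apply]
    have key : ∀ z ∈ Submodule.span ℂ {x : ExteriorAlgebra ℂ (E [⋀^Fin 1]→L[ℝ] ℂ) | ∃ m : Fin p → ι → ℚ,
        (∀ i j, Q (m i) (m j) = 0) ∧ x = φ (ExteriorAlgebra.ιMulti ℚ p m)},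
        Rc z ∈ Submodule.span ℂ {ψ : E [⋀^Fin p]→L[ℝ] ℂ | ∃ q : Fin p → ι → ℚ,
          (∀ i j, η ![Φ (ratVec (q i)), Φ (ratVec (q j))] = 0) ∧
          ∀ x : Fin p → E, ψ x = (Matrix.of fun i j ↦ (η ![Φ (ratVec (q i)), x j] : ℂ)).det} := by
      intro z hz
      induction hz using Submodule.span_induction with
      | mem z h =>
        obtain ⟨m, hm, rfl⟩ := h
        refine Submodule.subset_span ⟨m, fun i j ↦ by rw [← hQ, hm i j, Rat.cast_zero], fun x ↦ ?_⟩
        rw [hRc, ← hR]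
        exact ratRealize_ιMulti_apply Φ hθ hφ hR m x
      | zero =>
        rw [map_zero]
        exact Submodule.zero_mem _
      | add z z' _ _ hz hz' =>
        rw [map_add]
        exact Submodule.add_mem _ hz hz'
      | smul a z _ hz =>
        rw [map_smul]
        exact Submodule.smul_mem _ a hz
    rw [hx']
    exact key _ hy
  · rintro ψ ⟨q, hq, hψ⟩
    exact det_twoForm_mem_primitiveForms hnd (fun i ↦ Φ (ratVec (q i))) hq hψ

end ComplexSpan

end ComplexTorus

end Literature.Geometry.Kaehler
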